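import Summits.RiemannHypothesis.RiemannHypothesis.Theorems.PfPersistencePerronFakeNodelessLobes
import HarnessLib

/-!
# PF persistence — PERRON-FAKE (S6), part 6b: the LOBE-PLANE LAW of a nodal ground state
# (equal excess of the two lobes; the two-level law "a node costs `b/(pq)` of gap"), every real table,
# every window

`pub-rhpf` cell, unit `pub-rhpf-prover-perron` (S6; CASE-DAG §6 row PERRON-FAKE; leaves G1.01 / G1.02,
FAKE column; table-side reading of leaves G1.12 / G1.13 / G1.19).  **Mechanism / rigidity campaign;
no RH claims.**  RH-free, definition-free: Mathlib + proved tree files only.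

Parts 1–5 (`PfPersistencePerronFakeNodeless{Fold,Criterion,SmallWindow,,EvenKernel,EvenWindow,FoldGain,
FoldBarrier,FoldBarrierEven}`) settled what FOLDING `u ↦ |u|` can and cannot do: it proves nodelessness
of every real (resp. even) ground state of the FULL windowed form `Q = Q^w_a = tableClosedForm a w` of
every real table on `0 < a ≤ 1/8` (resp. `≤ 11/40`) and provably nothing at `a ≥ 3/20` (resp. `≥ 3/10`),
in particular nothing at any served window.  This part proves what the GROUND-STATE PROPERTY ITSELF
forces on the two lobes `u⁺ = max(u,0)`, `u⁻ = max(−u,0)` of a real ground state at EVERY window and for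
EVERY real table — the structure a served-window nodelessness proof has to start from.  Toolbox: part 6a
(`PfPersistencePerronFakeNodelessLobes`: polarisation of `Q` on the class `coreAdm a`, the lobes).

Notation: `E = Q(u)` (the ground level; `∫|u|² = 1`), `p = ∫(u⁺)²`, `q = ∫(u⁻)²` (`p + q = 1`), and the
LOBE COUPLING `b = (Q(|u|) − Q(u))/4` (`= −∫ u⁻ S^w_u ≥ 0` by parts 1 and 3: `tableClosedForm_abs_sub_eq`,
`IsTableGround.fold_le`; `S^w_u = tableSource a w u`).

* §3 (PROVED) **THE LOBE-PLANE LAW** (`lobePlane_law`; `IsTableGround.lobePlane`,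
  `IsTableEvenGround.lobePlane`): for a real ground state of the full class (resp. of the even sector),
  for all real `s, t`,
  `Q(s u⁺ + t u⁻) = E (s² p + t² q) + b (s + t)²`
  — on the lobe plane the form is the ground level plus a RANK-ONE defect along `|u| = u⁺ + u⁻`, of
  strength the lobe coupling.  Equivalently (`IsTableGround.posLobe_excess / negLobe_excess`) the EQUAL
  EXCESS LAW `Q(u⁺) = E p + b`, `Q(u⁻) = E q + b`: both lobes are excited by the SAME amount `b` above the
  ground level, whatever their masses (for a LOCAL form `b = 0` and this is the first line of Courant's
  nodal-domain argument; the windowed Weil form is nonlocal and `b` is exactly the fold gain / 4,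
  `lobeCoupling_eq_source`).  Proof: minimality on the plane makes the excess form
  `s²(Q(u⁺) − Ep) + t²(Q(u⁻) − Eq) + st(Q(|u|) − Q(u⁺) − Q(u⁻))` positive semidefinite and zero at
  `(1, −1)`, so `(1, −1)` is in its kernel (two discriminants).
* §4 (PROVED) **THE TWO-LEVEL LAW** (`IsTableGround.antiLobe_coreAdm / antiLobe_orth / antiLobe_mass /
  IsTableGround.antiLobe_level`): the anti-lobe state `v = q u⁺ + p u⁻` is a member of the class,
  `L²`-orthogonal to `u`, of mass `pq`, at level `Q(v) = E pq + b` — a node forces a second member,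
  orthogonal to the ground state, exactly `b/(pq)` above the ground level; hence under a SPECTRAL-GAP
  hypothesis BY NAME (`(E + γ)‖v‖² ≤ Q(v)` for every member `v ⊥ u`) A NODE COSTS GAP:
  `γ · pq ≤ b = −∫u⁻S^w_u` (`IsTableGround.gap_mul_lobeMass_le`, `…_source`): the nodal masses of a
  ground state are controlled by the gap of the table over the lobe coupling, at every window and for
  every real table.  No instance (gap DATA of mv811 / B23 / U23) is claimed here.

References: R. Courant, D. Hilbert, *Methoden der Mathematischen Physik* I (1924), Kap. VI §6 (the
nodal-domain argument, local case `b = 0`); M. Reed, B. Simon, *Methods of Modern Mathematical Physics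
IV* (1978) §XIII.12 (nodeless ground states) and §XIII.1 (min–max); R. L. Frank, E. Lenzmann,
L. Silvestre, Comm. Pure Appl. Math. 69 (2016) 1671–1726, arXiv:1302.2652 (nodal bounds for NONLOCAL
forms need more than Courant's argument); E. Bombieri, Rend. Mat. Acc. Lincei (9) 11 (2000) 183–233,
Thm 2 (the windowed form).  The proofs below do not invoke them as facts.
-/

set_option linter.dupNamespace false

noncomputable section

open MeasureTheory Set Filter Complex
open scoped Real Topology ComplexConjugate

namespace Summit.RiemannHypothesis.RiemannHypothesis.Theorems.PfPersistence

open Literature.NumberTheory.LFunctions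
open Summit.RiemannHypothesis.RiemannHypothesis.Theorems.EvenWinsBeyondArch

/-! ## §3 The lobe-plane law of a ground state -/

section LobePlane

variable {a : ℝ} {w : ℕ → ℝ} {u : ℝ → ℝ}

/-- **THE LOBE-PLANE LAW (abstract form).**  Let `u` be a real normalised member of the class whose
Rayleigh quotient is minimal on its own lobe plane `{s u⁺ + t u⁻}`.  Then for all real `s, t`
`Q(s u⁺ + t u⁻) = Q(u)(s² p + t² q) + ¼(Q(|u|) − Q(u))(s + t)²` (`p = ∫(u⁺)²`, `q = ∫(u⁻)²`): on the lobe
plane the form is the ground level plus a rank-one defect along `|u|`. [folklore] -/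
theorem lobePlane_law (w : ℕ → ℝ) (hU : coreAdm a (fun x ↦ ((u x : ℝ) : ℂ)))
    (hn : ∫ x, ‖((u x : ℝ) : ℂ)‖ ^ 2 = 1)
    (hmin : ∀ s t : ℝ, tableClosedForm a w (fun x ↦ ((u x : ℝ) : ℂ)) *
        ∫ x, ‖(s • (fun x ↦ ((max (u x) 0 : ℝ) : ℂ)) + t • fun x ↦ ((max (-u x) 0 : ℝ) : ℂ)) x‖ ^ 2 ≤
      tableClosedForm a w (s • (fun x ↦ ((max (u x) 0 : ℝ) : ℂ)) + t • fun x ↦ ((max (-u x) 0 : ℝ) : ℂ)))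
    (s t : ℝ) :
    tableClosedForm a w (s • (fun x ↦ ((max (u x) 0 : ℝ) : ℂ)) + t • fun x ↦ ((max (-u x) 0 : ℝ) : ℂ)) =
      tableClosedForm a w (fun x ↦ ((u x : ℝ) : ℂ)) *
          (s ^ 2 * (∫ x, max (u x) 0 ^ 2) + t ^ 2 * ∫ x, max (-u x) 0 ^ 2) +
        (tableClosedForm a w (fun x ↦ ((|u x| : ℝ) : ℂ)) - tableClosedForm a w (fun x ↦ ((u x : ℝ) : ℂ))) /
          4 * (s + t) ^ 2 := by
  have hF := coreAdm_posLobe hU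
  have hH := coreAdm_negLobe hU
  -- the polarised form on the plane
  have key : ∀ s t : ℝ,
      tableClosedForm a w (s • (fun x ↦ ((max (u x) 0 : ℝ) : ℂ)) + t • fun x ↦ ((max (-u x) 0 : ℝ) : ℂ)) =
        s ^ 2 * tableClosedForm a w (fun x ↦ ((max (u x) 0 : ℝ) : ℂ)) +
          t ^ 2 * tableClosedForm a w (fun x ↦ ((max (-u x) 0 : ℝ) : ℂ)) +
          s * t * (tableClosedForm a w (fun x ↦ ((|u x| : ℝ) : ℂ)) -
            tableClosedForm a w (fun x ↦ ((max (u x) 0 : ℝ) : ℂ)) -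
            tableClosedForm a w (fun x ↦ ((max (-u x) 0 : ℝ) : ℂ))) := fun s t ↦ by
    rw [tableClosedForm_smul_add_smul w hF hH, posLobe_add_negLobe]
  -- abbreviations
  set E := tableClosedForm a w (fun x ↦ ((u x : ℝ) : ℂ)) with hE
  set QF := tableClosedForm a w (fun x ↦ ((max (u x) 0 : ℝ) : ℂ)) with hQF
  set QH := tableClosedForm a w (fun x ↦ ((max (-u x) 0 : ℝ) : ℂ)) with hQH
  set QA := tableClosedForm a w (fun x ↦ ((|u x| : ℝ) : ℂ)) with hQA
  set p := ∫ x, max (u x) 0 ^ 2 with hp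
  set q := ∫ x, max (-u x) 0 ^ 2 with hq
  have hpq : p + q = 1 := by rw [hp, hq, lobeMass_add hU, hn]
  -- the state itself is the point `(1, −1)` of the plane
  have hu1 : E = QF + QH - (QA - QF - QH) := by
    have h := key 1 (-1)
    rw [posLobe_sub_negLobe] at h
    rw [hE, h]
    ring
  -- positive semidefiniteness of the excess form on the plane
  have hpsd : ∀ s t : ℝ, 0 ≤ s ^ 2 * (QF - E * p) + t ^ 2 * (QH - E * q) + s * t * (QA - QF - QH) := by
    intro s t
    have h := hmin s t
    rw [integral_norm_sq_lobes hU, key] at h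
    nlinarith [h]
  -- it vanishes at `(1, −1)`, so `(1, −1)` is in its kernel
  have h0 : (QF - E * p) + (QH - E * q) - (QA - QF - QH) = 0 := by
    have : E * (p + q) = E := by rw [hpq, mul_one]
    linarith
  have hC : QA - QF - QH = 2 * (QH - E * q) := by
    have hquad : ∀ τ : ℝ, 0 ≤ (QH - E * q) * (τ * τ) +
        ((QA - QF - QH) - 2 * (QH - E * q)) * τ + 0 := by
      intro τ
      have h := hpsd 1 (τ - 1)
      have e : (QH - E * q) * (τ * τ) + ((QA - QF - QH) - 2 * (QH - E * q)) * τ + 0 =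
          (1 ^ 2 * (QF - E * p) + (τ - 1) ^ 2 * (QH - E * q) + 1 * (τ - 1) * (QA - QF - QH)) -
            ((QF - E * p) + (QH - E * q) - (QA - QF - QH)) := by ring
      rw [e, h0, sub_zero]
      exact h
    have hd := discrim_le_zero hquad
    rw [discrim] at hd
    have hsq : ((QA - QF - QH) - 2 * (QH - E * q)) ^ 2 = 0 :=
      le_antisymm (by nlinarith [hd]) (sq_nonneg _)
    have := pow_eq_zero_iff (two_ne_zero) |>.1 hsq
    linarith
  have hA : QA - QF - QH = 2 * (QF - E * p) := by
    have hquad : ∀ τ : ℝ, 0 ≤ (QF - E * p) * (τ * τ) +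
        ((QA - QF - QH) - 2 * (QF - E * p)) * τ + 0 := by
      intro τ
      have h := hpsd (τ - 1) 1
      have e : (QF - E * p) * (τ * τ) + ((QA - QF - QH) - 2 * (QF - E * p)) * τ + 0 =
          ((τ - 1) ^ 2 * (QF - E * p) + 1 ^ 2 * (QH - E * q) + (τ - 1) * 1 * (QA - QF - QH)) -
            ((QF - E * p) + (QH - E * q) - (QA - QF - QH)) := by ring
      rw [e, h0, sub_zero]
      exact h
    have hd := discrim_le_zero hquad
    rw [discrim] at hd
    have hsq : ((QA - QF - QH) - 2 * (QF - E * p)) ^ 2 = 0 :=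
      le_antisymm (by nlinarith [hd]) (sq_nonneg _)
    have := pow_eq_zero_iff (two_ne_zero) |>.1 hsq
    linarith
  -- the coupling in terms of `Q(|u|) − Q(u)`
  have hQA1 : QA = E + 2 * (QA - QF - QH) := by
    have h := key 1 1
    have e : ((1 : ℝ) • (fun x ↦ ((max (u x) 0 : ℝ) : ℂ)) + (1 : ℝ) • fun x ↦ ((max (-u x) 0 : ℝ) : ℂ)) =
        fun x ↦ ((|u x| : ℝ) : ℂ) := by
      rw [one_smul, one_smul, posLobe_add_negLobe]
    rw [e] at h
    nlinarith [h, hu1, hA, hC, hpq]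
  rw [key s t]
  nlinarith [hA, hC, hQA1, hpq]

/-- The lobe-plane combinations of an even function are even. [folklore] -/
theorem lobes_even (he : ∀ x, u (-x) = u x) (s t : ℝ) (x : ℝ) :
    (s • (fun x ↦ ((max (u x) 0 : ℝ) : ℂ)) + t • fun x ↦ ((max (-u x) 0 : ℝ) : ℂ)) (-x) =
      (s • (fun x ↦ ((max (u x) 0 : ℝ) : ℂ)) + t • fun x ↦ ((max (-u x) 0 : ℝ) : ℂ)) x := by
  simp only [Pi.add_apply, dt_smul_apply, he]

/-- **THE LOBE-PLANE LAW for a ground state of the full class** (every real table, every window):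
`Q(s u⁺ + t u⁻) = E (s² p + t² q) + ¼(Q(|u|) − E)(s + t)²`, `E = Q(u)`. [folklore] -/
theorem IsTableGround.lobePlane (hG : IsTableGround a w (fun x ↦ ((u x : ℝ) : ℂ))) (s t : ℝ) :
    tableClosedForm a w (s • (fun x ↦ ((max (u x) 0 : ℝ) : ℂ)) + t • fun x ↦ ((max (-u x) 0 : ℝ) : ℂ)) =
      tableClosedForm a w (fun x ↦ ((u x : ℝ) : ℂ)) *
          (s ^ 2 * (∫ x, max (u x) 0 ^ 2) + t ^ 2 * ∫ x, max (-u x) 0 ^ 2) +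
        (tableClosedForm a w (fun x ↦ ((|u x| : ℝ) : ℂ)) - tableClosedForm a w (fun x ↦ ((u x : ℝ) : ℂ))) /
          4 * (s + t) ^ 2 :=
  lobePlane_law w hG.1 hG.2.1
    (fun s t ↦ hG.2.2 _ (((coreAdm_posLobe hG.1).real_smul s).add ((coreAdm_negLobe hG.1).real_smul t)))
    s t

/-- **THE LOBE-PLANE LAW for an even-sector ground state** (every real table, every window). [folklore] -/
theorem IsTableEvenGround.lobePlane (hG : IsTableEvenGround a w (fun x ↦ ((u x : ℝ) : ℂ)))
    (he : ∀ x, u (-x) = u x) (s t : ℝ) :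
    tableClosedForm a w (s • (fun x ↦ ((max (u x) 0 : ℝ) : ℂ)) + t • fun x ↦ ((max (-u x) 0 : ℝ) : ℂ)) =
      tableClosedForm a w (fun x ↦ ((u x : ℝ) : ℂ)) *
          (s ^ 2 * (∫ x, max (u x) 0 ^ 2) + t ^ 2 * ∫ x, max (-u x) 0 ^ 2) +
        (tableClosedForm a w (fun x ↦ ((|u x| : ℝ) : ℂ)) - tableClosedForm a w (fun x ↦ ((u x : ℝ) : ℂ))) /
          4 * (s + t) ^ 2 :=
  lobePlane_law w hG.1 hG.2.2.1
    (fun s t ↦ hG.2.2.2 _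
      (((coreAdm_posLobe hG.1).real_smul s).add ((coreAdm_negLobe hG.1).real_smul t)) (lobes_even he s t))
    s t

/-- **EQUAL EXCESS, positive lobe**: `Q(u⁺) = E ∫(u⁺)² + ¼(Q(|u|) − E)`. [folklore] -/
theorem IsTableGround.posLobe_excess (hG : IsTableGround a w (fun x ↦ ((u x : ℝ) : ℂ))) :
    tableClosedForm a w (fun x ↦ ((max (u x) 0 : ℝ) : ℂ)) =
      tableClosedForm a w (fun x ↦ ((u x : ℝ) : ℂ)) * (∫ x, max (u x) 0 ^ 2) +
        (tableClosedForm a w (fun x ↦ ((|u x| : ℝ) : ℂ)) - tableClosedForm a w (fun x ↦ ((u x : ℝ) : ℂ))) /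
          4 := by
  have h := hG.lobePlane 1 0
  rw [zero_smul, add_zero, one_smul] at h
  rw [h]
  ring

/-- **EQUAL EXCESS, negative lobe**: `Q(u⁻) = E ∫(u⁻)² + ¼(Q(|u|) − E)` — the SAME excess. [folklore] -/
theorem IsTableGround.negLobe_excess (hG : IsTableGround a w (fun x ↦ ((u x : ℝ) : ℂ))) :
    tableClosedForm a w (fun x ↦ ((max (-u x) 0 : ℝ) : ℂ)) =
      tableClosedForm a w (fun x ↦ ((u x : ℝ) : ℂ)) * (∫ x, max (-u x) 0 ^ 2) +
        (tableClosedForm a w (fun x ↦ ((|u x| : ℝ) : ℂ)) - tableClosedForm a w (fun x ↦ ((u x : ℝ) : ℂ))) /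
          4 := by
  have h := hG.lobePlane 0 1
  rw [zero_smul, zero_add, one_smul] at h
  rw [h]
  ring

/-- **The lobe coupling is the source pairing** (parts 1, 3): `¼(Q(|u|) − Q(u)) = −∫ u⁻ S^w_u`.
[folklore] -/
theorem lobeCoupling_eq_source (w : ℕ → ℝ) (hum : Measurable u)
    (hU : coreAdm a (fun x ↦ ((u x : ℝ) : ℂ))) :
    (tableClosedForm a w (fun x ↦ ((|u x| : ℝ) : ℂ)) - tableClosedForm a w (fun x ↦ ((u x : ℝ) : ℂ))) / 4 =
      -∫ y, max (-u y) 0 * tableSource a w u y := by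
  have h := (tableClosedForm_abs_sub_eq w hum hU).1
  linarith

end LobePlane

/-! ## §4 The two-level law: the anti-lobe state and the price of a node in gap -/

section TwoLevel

variable {a : ℝ} {w : ℕ → ℝ} {u : ℝ → ℝ}

/-- `max(r,0) · max(−r,0) = 0`. [folklore] -/
private theorem posLobe_mul_negLobe (r : ℝ) : max r 0 * max (-r) 0 = 0 := by
  rcases le_total 0 r with h | h
  · rw [max_eq_right (neg_nonpos.2 h)]; ring
  · rw [max_eq_right h]; ring

/-- `max(r,0) − max(−r,0) = r`. [folklore] -/
private theorem posLobe_sub_negLobe_real (r : ℝ) : max r 0 - max (-r) 0 = r := by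
  rcases le_total 0 r with h | h
  · rw [max_eq_left h, max_eq_right (neg_nonpos.2 h)]; ring
  · rw [max_eq_right h, max_eq_left (neg_nonneg.2 h)]; ring

/-- The anti-lobe state `v = q u⁺ + p u⁻` is a member of the class. [folklore] -/
theorem IsTableGround.antiLobe_coreAdm (hG : IsTableGround a w (fun x ↦ ((u x : ℝ) : ℂ))) :
    coreAdm a ((∫ x, max (-u x) 0 ^ 2) • (fun x ↦ ((max (u x) 0 : ℝ) : ℂ)) +
      (∫ x, max (u x) 0 ^ 2) • fun x ↦ ((max (-u x) 0 : ℝ) : ℂ)) :=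
  ((coreAdm_posLobe hG.1).real_smul _).add ((coreAdm_negLobe hG.1).real_smul _)

/-- The anti-lobe state is `L²`-orthogonal to the ground state: `⟨q u⁺ + p u⁻, u⟩ = qp − pq = 0`.
[folklore] -/
theorem antiLobe_orth (hU : coreAdm a (fun x ↦ ((u x : ℝ) : ℂ))) :
    ∫ x, ((((∫ x, max (-u x) 0 ^ 2) • (fun x ↦ ((max (u x) 0 : ℝ) : ℂ)) +
        (∫ x, max (u x) 0 ^ 2) • fun x ↦ ((max (-u x) 0 : ℝ) : ℂ)) x) *
        conj (((u x : ℝ) : ℂ))).re = 0 := by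
  have e : ∀ x, ((((∫ x, max (-u x) 0 ^ 2) • (fun x ↦ ((max (u x) 0 : ℝ) : ℂ)) +
      (∫ x, max (u x) 0 ^ 2) • fun x ↦ ((max (-u x) 0 : ℝ) : ℂ)) x) * conj (((u x : ℝ) : ℂ))).re =
      (∫ x, max (-u x) 0 ^ 2) * max (u x) 0 ^ 2 - (∫ x, max (u x) 0 ^ 2) * max (-u x) 0 ^ 2 := by
    intro x
    rw [Pi.add_apply, dt_smul_apply, dt_smul_apply, Complex.conj_ofReal]
    simp only [← Complex.ofReal_mul, ← Complex.ofReal_add, Complex.ofReal_re]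
    have h := posLobe_mul_negLobe (u x)
    have h2 := posLobe_sub_negLobe_real (u x)
    linear_combination (-((∫ x, max (-u x) 0 ^ 2) * max (u x) 0 +
      (∫ x, max (u x) 0 ^ 2) * max (-u x) 0)) * h2 +
      ((∫ x, max (u x) 0 ^ 2) - ∫ x, max (-u x) 0 ^ 2) * h
  simp_rw [e]
  rw [integral_sub ((integrable_posLobe_sq hU).const_mul _) ((integrable_negLobe_sq hU).const_mul _),
    integral_const_mul, integral_const_mul]
  ring

/-- The anti-lobe state has mass `pq (p + q)`. [folklore] -/
theorem antiLobe_mass (hU : coreAdm a (fun x ↦ ((u x : ℝ) : ℂ))) :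
    ∫ x, ‖(((∫ x, max (-u x) 0 ^ 2) • (fun x ↦ ((max (u x) 0 : ℝ) : ℂ)) +
        (∫ x, max (u x) 0 ^ 2) • fun x ↦ ((max (-u x) 0 : ℝ) : ℂ)) x)‖ ^ 2 =
      (∫ x, max (u x) 0 ^ 2) * (∫ x, max (-u x) 0 ^ 2) *
        ((∫ x, max (u x) 0 ^ 2) + ∫ x, max (-u x) 0 ^ 2) := by
  rw [integral_norm_sq_lobes hU]
  ring

/-- **THE TWO-LEVEL LAW**: the anti-lobe state of a ground state sits at level
`Q(q u⁺ + p u⁻) = E · pq + ¼(Q(|u|) − E)` (mass `pq`, `L²`-orthogonal to `u`): a node forces a second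
member of the class, orthogonal to the ground state, exactly `b/(pq)` above the ground level. [folklore] -/
theorem IsTableGround.antiLobe_level (hG : IsTableGround a w (fun x ↦ ((u x : ℝ) : ℂ))) :
    tableClosedForm a w ((∫ x, max (-u x) 0 ^ 2) • (fun x ↦ ((max (u x) 0 : ℝ) : ℂ)) +
        (∫ x, max (u x) 0 ^ 2) • fun x ↦ ((max (-u x) 0 : ℝ) : ℂ)) =
      tableClosedForm a w (fun x ↦ ((u x : ℝ) : ℂ)) *
          ((∫ x, max (u x) 0 ^ 2) * ∫ x, max (-u x) 0 ^ 2) +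
        (tableClosedForm a w (fun x ↦ ((|u x| : ℝ) : ℂ)) - tableClosedForm a w (fun x ↦ ((u x : ℝ) : ℂ))) /
          4 := by
  have hpq : (∫ x, max (u x) 0 ^ 2) + ∫ x, max (-u x) 0 ^ 2 = 1 := by rw [lobeMass_add hG.1, hG.2.1]
  rw [hG.lobePlane]
  set p := ∫ x, max (u x) 0 ^ 2
  set q := ∫ x, max (-u x) 0 ^ 2
  have h3 : q ^ 2 * p + p ^ 2 * q = p * q := by
    rw [show q ^ 2 * p + p ^ 2 * q = p * q * (p + q) by ring, hpq, mul_one]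
  have h4 : (q + p) ^ 2 = 1 := by rw [add_comm, hpq, one_pow]
  rw [h3, h4, mul_one]

/-- **A NODE COSTS GAP** (the spectral-gap hypothesis BY NAME): if every member of the class
`L²`-orthogonal to the ground state `u` lies at level `≥ E + γ`, then `γ · pq ≤ ¼(Q(|u|) − Q(u))` — the
product of the lobe masses is at most the lobe coupling over the gap. [folklore] -/
theorem IsTableGround.gap_mul_lobeMass_le (hG : IsTableGround a w (fun x ↦ ((u x : ℝ) : ℂ))) {γ : ℝ}
    (hgap : ∀ v : ℝ → ℂ, coreAdm a v → ∫ x, (v x * conj (((u x : ℝ) : ℂ))).re = 0 →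
      (tableClosedForm a w (fun x ↦ ((u x : ℝ) : ℂ)) + γ) * ∫ x, ‖v x‖ ^ 2 ≤ tableClosedForm a w v) :
    γ * ((∫ x, max (u x) 0 ^ 2) * ∫ x, max (-u x) 0 ^ 2) ≤
      (tableClosedForm a w (fun x ↦ ((|u x| : ℝ) : ℂ)) - tableClosedForm a w (fun x ↦ ((u x : ℝ) : ℂ))) /
        4 := by
  have hpq : (∫ x, max (u x) 0 ^ 2) + ∫ x, max (-u x) 0 ^ 2 = 1 := by rw [lobeMass_add hG.1, hG.2.1]
  have h := hgap _ hG.antiLobe_coreAdm (antiLobe_orth hG.1)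
  rw [antiLobe_mass hG.1, hG.antiLobe_level, hpq, mul_one] at h
  nlinarith [h]

/-- **A NODE COSTS GAP, source form**: under the gap hypothesis, `γ · pq ≤ −∫ u⁻ S^w_u`. [folklore] -/
theorem IsTableGround.gap_mul_lobeMass_le_source (hum : Measurable u)
    (hG : IsTableGround a w (fun x ↦ ((u x : ℝ) : ℂ))) {γ : ℝ}
    (hgap : ∀ v : ℝ → ℂ, coreAdm a v → ∫ x, (v x * conj (((u x : ℝ) : ℂ))).re = 0 →
      (tableClosedForm a w (fun x ↦ ((u x : ℝ) : ℂ)) + γ) * ∫ x, ‖v x‖ ^ 2 ≤ tableClosedForm a w v) :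
    γ * ((∫ x, max (u x) 0 ^ 2) * ∫ x, max (-u x) 0 ^ 2) ≤ -∫ y, max (-u y) 0 * tableSource a w u y := by
  rw [← lobeCoupling_eq_source w hum hG.1]
  exact hG.gap_mul_lobeMass_le hgap

end TwoLevel

end Summit.RiemannHypothesis.RiemannHypothesis.Theorems.PfPersistence

end
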